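import Literature.AnabelianGeometry.SemiGraphs.TemperedPiBranchStabilizerRecentred
import Literature.AnabelianGeometry.SemiGraphs.TemperedPiPointSeqThroughVertex
import HarnessLib

/-!
# [SemiAnbd] Thm 3.7 (iii) / Cor 3.9 (R3c) for TOPOLOGICALLY CYCLIC edge groups: fixed branches are
# TRANSPORTED between tree vertices over one base vertex («switch-freeness» at one level, proof-only)

Mochizuki, *Semi-graphs of anabelioids*, Publ. RIMS **42** (2006), §2 Remark 2.2.1 p. 24 ("the image
of each `Π_b` in `Π_𝒢` is equal to the stabilizer of a compatible system of edges") and §3 Theorem 3.7 (iii),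
proof p. 41, third paragraph, with the author's *Comments* (2020) (6)(b); Corollary 3.9, proof p. 43
l. 13 (the cell's step (R3c), FACT-LIST rows F-2772 `EdgeLikeCentralizerAt` / F-2773 `EdgeLikeCentralizer`)
[cite: MochizukiSemiAnbd2006, Thm 3.7(iii) p.41].

PROOF-ONLY (cell abc-iut, block F, seat abc-iut-f-175 gen 3; brick (A) of «CONFINED@TOP-CYCLIC-TREES», the
instance class «tree-shaped `𝔾`, topologically cyclic edge groups» for the infinite-valence residual of
F-2772/F-2773; no definition, no named fact).  At ONE level `n` of a Galois tower `D`, the stabiliser in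
`Gal(𝒢_{∞,n}/𝒢)` of a branch of `𝔾̃_n` over a base branch `b₀` with TOPOLOGICALLY CYCLIC edge group is a
conjugate of ONE finite cyclic group (Rmk. 2.2.1 at one level, point form: `CovObj.brOf_eq_brOf_iff` +
`PointSeq.eq_gal`); a finite cyclic group has one subgroup of each order, so the image of any subgroup `C`
of `π₁^temp(𝒢)` is THE subgroup of its order in the stabiliser of every `C`-fixed branch over `b₀`.  Hence
(`exists_fixed_branch_transport`): **if `C` fixes the edge of a branch over `b₀` at a tree vertex `v_a`
over `w`, and the edges of branches over `b₀` and over `b₁` at another tree vertex `v` over `w`, then `C`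
fixes the edge of a branch over `b₁` AT `v_a`** — the engine forbidding the «switches» through far branches
at a vertex of infinite valence (abc-iut-f-172 gen 5's residual (II-b)); bricks (B) path transport and
(C) confinement are the sequels.

Honest framing: one sufficient condition (topologically cyclic edge groups); the ∀-closures F-2773 /
F-1732 are NOT claimed; nothing here bears on [IUTchIII] Cor. 3.12; typed ≠ proved elsewhere.
-/

namespace Literature.AnabelianGeometry.SemiGraphs

open CategoryTheory Topology

universe u

/-! ### Two group-theoretic preliminaries -/

/-- In a finite cyclic group a subgroup is the set of solutions of `x ^ |H| = 1`.
[cite: MochizukiSemiAnbd2006, Rmk 2.2.1 p.24] -/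
private theorem Subgroup.mem_iff_pow_card_eq_one_of_isCyclic' {Z : Type*} [Group Z] [Finite Z]
    [IsCyclic Z] (H : Subgroup Z) (x : Z) : x ∈ H ↔ x ^ Nat.card H = 1 := by
  classical
  constructor
  · intro hx
    have h := pow_card_eq_one' (G := H) (x := ⟨x, hx⟩)
    rw [Subtype.ext_iff, Subgroup.coe_pow, Subgroup.coe_one] at h
    exact h
  · intro hx
    let _ : Fintype Z := Fintype.ofFinite Z
    set F : Finset Z := Finset.univ.filter fun a : Z => a ^ Nat.card H = 1 with hFdef
    set S : Finset Z := Finset.univ.filter fun a : Z => a ∈ H with hSdef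
    have hpos : 0 < Nat.card H := Nat.card_pos
    have hF : F.card ≤ Nat.card H := by
      rw [hFdef]
      convert IsCyclic.card_pow_eq_one_le (α := Z) hpos using 2
    have hS : S.card = Nat.card H := by
      rw [hSdef, Nat.card_eq_fintype_card, ← Fintype.card_subtype]
    have hSF : S ⊆ F := by
      intro a ha
      rw [hSdef, Finset.mem_filter] at ha
      rw [hFdef, Finset.mem_filter]
      refine ⟨Finset.mem_univ _, ?_⟩
      have h := pow_card_eq_one' (G := H) (x := ⟨a, ha.2⟩)
      rw [Subtype.ext_iff, Subgroup.coe_pow, Subgroup.coe_one] at h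
      exact h
    have hEq : S = F := Finset.eq_of_subset_of_card_le hSF (by rw [hS]; exact hF)
    have hxF : x ∈ F := by
      rw [hFdef, Finset.mem_filter]
      exact ⟨Finset.mem_univ _, hx⟩
    rw [← hEq, hSdef, Finset.mem_filter] at hxF
    exact hxF.2

/-- **A finite cyclic subgroup `Z` has at most one subgroup of each order**: two subgroups of the
ambient group contained in `Z` with the same cardinality coincide. [cite: MochizukiSemiAnbd2006, Rmk 2.2.1 p.24] -/
private theorem Subgroup.eq_of_le_of_card_eq_of_isCyclic' {Γ : Type*} [Group Γ] (Z : Subgroup Γ)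
    [Finite Z] [IsCyclic Z] {M₁ M₂ : Subgroup Γ} (h₁ : M₁ ≤ Z) (h₂ : M₂ ≤ Z)
    (hc : Nat.card M₁ = Nat.card M₂) : M₁ = M₂ := by
  have hc' : Nat.card (M₁.subgroupOf Z) = Nat.card (M₂.subgroupOf Z) := by
    rw [Nat.card_congr (Subgroup.subgroupOfEquivOfLe h₁).toEquiv,
      Nat.card_congr (Subgroup.subgroupOfEquivOfLe h₂).toEquiv, hc]
  have heq : M₁.subgroupOf Z = M₂.subgroupOf Z := by
    ext x
    rw [Subgroup.mem_iff_pow_card_eq_one_of_isCyclic' (M₁.subgroupOf Z),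
      Subgroup.mem_iff_pow_card_eq_one_of_isCyclic' (M₂.subgroupOf Z), hc']
  simpa [inf_eq_left.mpr h₁, inf_eq_left.mpr h₂] using Subgroup.subgroupOf_inj.mp heq

/-- The range of a continuous homomorphism from a topologically cyclic group into a discrete group is the
cyclic group generated by the image of the generator. [folklore] -/
private theorem MonoidHom.range_eq_zpowers_of_dense' {E : Type*} [Group E] [TopologicalSpace E]
    [IsTopologicalGroup E] {Γ : Type*} [Group Γ] [TopologicalSpace Γ] [DiscreteTopology Γ] (e₀ : E)
    (hgen : (Subgroup.zpowers e₀).topologicalClosure = ⊤) (τ : E →* Γ) (hτ : Continuous τ) :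
    τ.range = Subgroup.zpowers (τ e₀) := by
  apply le_antisymm
  · rintro _ ⟨t, rfl⟩
    have ht : t ∈ (Subgroup.zpowers e₀).topologicalClosure := by rw [hgen]; exact Subgroup.mem_top t
    have h1 : τ t ∈ closure (τ '' (Subgroup.zpowers e₀ : Set E)) :=
      image_closure_subset_closure_image hτ ⟨t, ht, rfl⟩
    have h2 : τ '' (Subgroup.zpowers e₀ : Set E) = (Subgroup.zpowers (τ e₀) : Set Γ) := by
      rw [← Subgroup.coe_map, MonoidHom.map_zpowers]
    rw [h2, (isClosed_discrete (Subgroup.zpowers (τ e₀) : Set Γ)).closure_eq] at h1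
    exact h1
  · rw [← MonoidHom.map_zpowers]
    exact Subgroup.map_le_range τ _

namespace ProfiniteSemiGraph

namespace GaloisLevelData

open Literature.AlgebraicGeometry.Frobenioids.QuasiTemperoid.BTempConnected (ρ_one_apply
  ρ_mul_apply ρ_inv_apply)

variable {𝒢 : ProfiniteSemiGraph.{u}} {D : GaloisLevelData 𝒢} {h𝒢 : 𝒢.IsCountable}

namespace PointSeq

variable {w : 𝒢.graph.Vertex} (P : D.PointSeq h𝒢 w)

/-! ### The one-level branch dictionary in point form -/

/-- Every point of the fibre of `𝒢_{∞,n}` over `w` is a `Gal`-translate of `P.pt n`. [cite: MochizukiSemiAnbd2006, Rmk 2.2.1 p.24] -/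
theorem exists_gal_fV_eq (n : ℕ) (y : ((D.cover h𝒢 n).SV w).obj.V) :
    ∃ σ : D.Gal h𝒢 n, (σ.hom.fV w).hom.hom (P.pt n) = y :=
  (D.S n).exists_aut_apply_eq' h𝒢 (D.W n) (D.htrans n) (P.pt n) y

/-- Products in `Gal(𝒢_{∞,n}/𝒢)` act by composition on points. [cite: MochizukiSemiAnbd2006, Rmk 2.2.1 p.24] -/
theorem mul_fV_apply (n : ℕ) (σ τ : D.Gal h𝒢 n) (y : ((D.cover h𝒢 n).SV w).obj.V) :
    ((σ * τ).hom.fV w).hom.hom y = (σ.hom.fV w).hom.hom ((τ.hom.fV w).hom.hom y) := rfl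

/-- `σ⁻¹` undoes `σ` on points. [cite: MochizukiSemiAnbd2006, Rmk 2.2.1 p.24] -/
theorem inv_fV_apply (n : ℕ) (σ : D.Gal h𝒢 n) (y : ((D.cover h𝒢 n).SV w).obj.V) :
    (σ⁻¹.hom.fV w).hom.hom ((σ.hom.fV w).hom.hom y) = y := by rw [← mul_fV_apply, inv_mul_cancel]; rfl

/-- **Stabiliser of the branch through the base point** (Rmk. 2.2.1 at one level, point form): for
`η ∈ Gal(𝒢_{∞,n}/𝒢)` and a base branch `b` at `w`, the branch `brOf b (P.pt n)` is fixed by `η` — i.e.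
`k · η(pt) = pt` for some `k ∈ Π_b` — iff `η = σ_n^k` for some `k ∈ Π_b`.
[cite: MochizukiSemiAnbd2006, Rmk 2.2.1 p.24] -/
theorem exists_branchSubgroup_ρ_apply_eq_iff (n : ℕ) (b : 𝒢.graph.Branch) (hb : 𝒢.graph.abuts b = some w)
    (η : D.Gal h𝒢 n) :
    (∃ k ∈ 𝒢.branchSubgroup b w hb, ((D.cover h𝒢 n).SV w).obj.ρ k ((η.hom.fV w).hom.hom (P.pt n)) = P.pt n) ↔
      η ∈ (𝒢.branchSubgroup b w hb).map ((D.proj h𝒢 n).comp P.decompHom) := by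
  constructor
  · rintro ⟨k, hk, hkη⟩
    refine ⟨k, hk, ?_⟩
    change P.gal n k = η
    symm
    apply P.eq_gal
    have h := congrArg (((D.cover h𝒢 n).SV w).obj.ρ k⁻¹) hkη
    rwa [← ρ_mul_apply, inv_mul_cancel, ρ_one_apply] at h
  · rintro ⟨k, hk, rfl⟩
    refine ⟨k, hk, ?_⟩
    change ((D.cover h𝒢 n).SV w).obj.ρ k (((P.gal n k).hom.fV w).hom.hom (P.pt n)) = P.pt n
    rw [P.gal_apply, ← ρ_mul_apply, mul_inv_cancel, ρ_one_apply]

/-- Translating the base point: `k · q(σ pt) = σ pt` for some `k ∈ Π_b` iff `k · (σ⁻¹ q σ)(pt) = pt` for some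
`k ∈ Π_b` (automorphisms commute with `Π_w`). [cite: MochizukiSemiAnbd2006, Rmk 2.2.1 p.24] -/
theorem exists_branchSubgroup_ρ_apply_eq_translate_iff (n : ℕ) (b : 𝒢.graph.Branch)
    (hb : 𝒢.graph.abuts b = some w) (q σ : D.Gal h𝒢 n) :
    (∃ k ∈ 𝒢.branchSubgroup b w hb, ((D.cover h𝒢 n).SV w).obj.ρ k
        ((q.hom.fV w).hom.hom ((σ.hom.fV w).hom.hom (P.pt n))) = (σ.hom.fV w).hom.hom (P.pt n)) ↔
      ∃ k ∈ 𝒢.branchSubgroup b w hb, ((D.cover h𝒢 n).SV w).obj.ρ k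
        (((σ⁻¹ * q * σ).hom.fV w).hom.hom (P.pt n)) = P.pt n := by
  constructor
  · rintro ⟨k, hk, h⟩
    refine ⟨k, hk, ?_⟩
    rw [mul_fV_apply, mul_fV_apply, ← CovHom.fV_ρ, h, inv_fV_apply]
  · rintro ⟨k, hk, h⟩
    refine ⟨k, hk, ?_⟩
    rw [mul_fV_apply, mul_fV_apply, ← CovHom.fV_ρ] at h
    have h' := congrArg (σ.hom.fV w).hom.hom h
    rwa [← mul_fV_apply n σ σ⁻¹, mul_inv_cancel] at h'

/-- **The image of a topologically cyclic edge group in `Gal(𝒢_{∞,n}/𝒢)` is ONE finite cyclic group**: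
if `Π_{e(b)}` is topologically generated by `t₀`, the image of `Π_b` under `h ↦ σ_n^h` is the (finite)
cyclic group generated by `σ_n^{b_*(t₀)}`. [cite: MochizukiSemiAnbd2006, Rmk 2.2.1 p.24] -/
theorem map_branchSubgroup_eq_zpowers (n : ℕ) (b : 𝒢.graph.Branch) (hb : 𝒢.graph.abuts b = some w)
    (t₀ : 𝒢.Ge (𝒢.graph.edgeOf b)) (hgen : (Subgroup.zpowers t₀).topologicalClosure = ⊤) :
    (𝒢.branchSubgroup b w hb).map ((D.proj h𝒢 n).comp P.decompHom) =
      Subgroup.zpowers (P.gal n (𝒢.brHom b w hb t₀)) := by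
  let τ : 𝒢.Ge (𝒢.graph.edgeOf b) →* D.Gal h𝒢 n :=
    ((D.proj h𝒢 n).comp P.decompHom).comp (𝒢.brHom b w hb).toMonoidHom
  have hτ : Continuous τ :=
    ((D.continuous_proj h𝒢 n).comp P.continuous_decompHom).comp (𝒢.brHom b w hb).continuous
  have hrange : τ.range = Subgroup.zpowers (τ t₀) := MonoidHom.range_eq_zpowers_of_dense' t₀ hgen τ hτ
  have hmap : (𝒢.branchSubgroup b w hb).map ((D.proj h𝒢 n).comp P.decompHom) = τ.range := by
    change ((𝒢.brHom b w hb).toMonoidHom.range).map _ = _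
    rw [← MonoidHom.range_comp]
  rw [hmap, hrange]
  rfl

/-- That image is finite (compact source, discrete target). [cite: MochizukiSemiAnbd2006, Rmk 2.2.1 p.24] -/
theorem finite_map_branchSubgroup (n : ℕ) (b : 𝒢.graph.Branch) (hb : 𝒢.graph.abuts b = some w) :
    ((𝒢.branchSubgroup b w hb).map ((D.proj h𝒢 n).comp P.decompHom) : Set (D.Gal h𝒢 n)).Finite := by
  let τ : 𝒢.Ge (𝒢.graph.edgeOf b) →* D.Gal h𝒢 n :=
    ((D.proj h𝒢 n).comp P.decompHom).comp (𝒢.brHom b w hb).toMonoidHom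
  have hτ : Continuous τ :=
    ((D.continuous_proj h𝒢 n).comp P.continuous_decompHom).comp (𝒢.brHom b w hb).continuous
  have hmap : (𝒢.branchSubgroup b w hb).map ((D.proj h𝒢 n).comp P.decompHom) = τ.range := by
    change ((𝒢.brHom b w hb).toMonoidHom.range).map _ = _
    rw [← MonoidHom.range_comp]
  rw [hmap, MonoidHom.coe_range]
  exact (isCompact_range hτ).finite_of_discrete

/-! ### LOCAL TRANSPORT at one level, point form -/

/-- **Local transport, point form.**  Let `Π_{e(b₀)}` be topologically cyclic and `M ≤ Gal(𝒢_{∞,n}/𝒢)` a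
subgroup fixing the branches `brOf b₀ (σ_a·pt)`, `brOf b₀ (σ·pt)` and `brOf b₁ (σ'·pt)` (each in the sense
`∃ k ∈ Π_b, k · q(y) = y`).  Then `M` fixes `brOf b₁ ((σ_a σ⁻¹ σ')·pt)`.  Proof: `σ_a⁻¹ M σ_a` and
`σ⁻¹ M σ` both lie in the ONE finite cyclic image of `Π_{b₀}` and have the same order, hence coincide;
so `σ_a σ⁻¹` normalises `M`. [cite: MochizukiSemiAnbd2006, Thm 3.7(iii) p.41] -/
theorem forall_exists_branchSubgroup_ρ_apply_eq_transport (n : ℕ) {b₀ b₁ : 𝒢.graph.Branch}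
    (hb₀ : 𝒢.graph.abuts b₀ = some w) (hb₁ : 𝒢.graph.abuts b₁ = some w)
    (t₀ : 𝒢.Ge (𝒢.graph.edgeOf b₀)) (hgen : (Subgroup.zpowers t₀).topologicalClosure = ⊤)
    (M : Subgroup (D.Gal h𝒢 n)) (σa σ σ' : D.Gal h𝒢 n)
    (hα : ∀ q ∈ M, ∃ k ∈ 𝒢.branchSubgroup b₀ w hb₀, ((D.cover h𝒢 n).SV w).obj.ρ k
        ((q.hom.fV w).hom.hom ((σa.hom.fV w).hom.hom (P.pt n))) = (σa.hom.fV w).hom.hom (P.pt n))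
    (hβ : ∀ q ∈ M, ∃ k ∈ 𝒢.branchSubgroup b₀ w hb₀, ((D.cover h𝒢 n).SV w).obj.ρ k
        ((q.hom.fV w).hom.hom ((σ.hom.fV w).hom.hom (P.pt n))) = (σ.hom.fV w).hom.hom (P.pt n))
    (hβ' : ∀ q ∈ M, ∃ k ∈ 𝒢.branchSubgroup b₁ w hb₁, ((D.cover h𝒢 n).SV w).obj.ρ k
        ((q.hom.fV w).hom.hom ((σ'.hom.fV w).hom.hom (P.pt n))) = (σ'.hom.fV w).hom.hom (P.pt n)) :
    ∀ q ∈ M, ∃ k ∈ 𝒢.branchSubgroup b₁ w hb₁, ((D.cover h𝒢 n).SV w).obj.ρ k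
        ((q.hom.fV w).hom.hom (((σa * σ⁻¹ * σ').hom.fV w).hom.hom (P.pt n))) =
          ((σa * σ⁻¹ * σ').hom.fV w).hom.hom (P.pt n) := by
  classical
  set Z : Subgroup (D.Gal h𝒢 n) := (𝒢.branchSubgroup b₀ w hb₀).map ((D.proj h𝒢 n).comp P.decompHom)
    with hZ
  haveI : Finite Z := (P.finite_map_branchSubgroup n b₀ hb₀).to_subtype
  haveI : IsCyclic Z := by
    rw [hZ, P.map_branchSubgroup_eq_zpowers n b₀ hb₀ t₀ hgen]
    infer_instance
  set M₁ : Subgroup (D.Gal h𝒢 n) := M.map (MulAut.conj σa⁻¹).toMonoidHom with hM₁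
  set M₂ : Subgroup (D.Gal h𝒢 n) := M.map (MulAut.conj σ⁻¹).toMonoidHom with hM₂
  have hM₁Z : M₁ ≤ Z := by
    rintro _ ⟨q, hq, rfl⟩
    have h := (P.exists_branchSubgroup_ρ_apply_eq_translate_iff n b₀ hb₀ q σa).mp (hα q hq)
    rw [P.exists_branchSubgroup_ρ_apply_eq_iff] at h
    have e : (MulAut.conj σa⁻¹).toMonoidHom q = σa⁻¹ * q * σa := by simp
    rw [e, hZ]
    exact h
  have hM₂Z : M₂ ≤ Z := by
    rintro _ ⟨q, hq, rfl⟩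
    have h := (P.exists_branchSubgroup_ρ_apply_eq_translate_iff n b₀ hb₀ q σ).mp (hβ q hq)
    rw [P.exists_branchSubgroup_ρ_apply_eq_iff] at h
    have e : (MulAut.conj σ⁻¹).toMonoidHom q = σ⁻¹ * q * σ := by simp
    rw [e, hZ]
    exact h
  have hcard : Nat.card M₁ = Nat.card M₂ := by
    rw [hM₁, hM₂, Subgroup.card_map_of_injective (MulAut.conj σa⁻¹).injective,
      Subgroup.card_map_of_injective (MulAut.conj σ⁻¹).injective]
  have hMM : M₁ = M₂ := Subgroup.eq_of_le_of_card_eq_of_isCyclic' Z hM₁Z hM₂Z hcard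
  intro q hq
  have hq₁ : (MulAut.conj σa⁻¹).toMonoidHom q ∈ M₁ := ⟨q, hq, rfl⟩
  rw [hMM] at hq₁
  obtain ⟨q', hq', hqq'⟩ := hq₁
  have hq_eq : q = σa * (σ⁻¹ * q' * σ) * σa⁻¹ := by
    simp only [MulEquiv.coe_toMonoidHom, MulAut.conj_apply, inv_inv] at hqq'
    rw [hqq']; group
  have hconj : (σa * σ⁻¹ * σ')⁻¹ * q * (σa * σ⁻¹ * σ') = σ'⁻¹ * q' * σ' := by
    rw [hq_eq]; group
  rw [P.exists_branchSubgroup_ρ_apply_eq_translate_iff, hconj,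
    ← P.exists_branchSubgroup_ρ_apply_eq_translate_iff]
  exact hβ' q' hq'

/-- Orbit bookkeeping: if `σ·pt` and `σ'·pt` lie in the same `Π_w`-orbit, so do `(τ σ⁻¹ σ')·pt` and
`τ·pt`. [cite: MochizukiSemiAnbd2006, Rmk 2.2.1 p.24] -/
theorem mk_mul_inv_mul_fV_eq (n : ℕ) (τ σ σ' : D.Gal h𝒢 n)
    (h : (Quot.mk (D.cover h𝒢 n).VRel ⟨w, (σ.hom.fV w).hom.hom (P.pt n)⟩ : (D.cover h𝒢 n).OVertex) =
      Quot.mk (D.cover h𝒢 n).VRel ⟨w, (σ'.hom.fV w).hom.hom (P.pt n)⟩) :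
    (Quot.mk (D.cover h𝒢 n).VRel ⟨w, ((τ * σ⁻¹ * σ').hom.fV w).hom.hom (P.pt n)⟩ :
        (D.cover h𝒢 n).OVertex) =
      Quot.mk (D.cover h𝒢 n).VRel ⟨w, (τ.hom.fV w).hom.hom (P.pt n)⟩ := by
  obtain ⟨g, hg⟩ := (D.cover h𝒢 n).exists_ρ_of_mk_eq_mk h
  -- `σ' pt = g · σ pt`, so `(τ σ⁻¹ σ') pt = g · τ pt`
  have e : ((τ * σ⁻¹ * σ').hom.fV w).hom.hom (P.pt n) =
      ((D.cover h𝒢 n).SV w).obj.ρ g ((τ.hom.fV w).hom.hom (P.pt n)) := by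
    rw [mul_fV_apply, mul_fV_apply, ← hg, CovHom.fV_ρ, inv_fV_apply, CovHom.fV_ρ]
  rw [e]
  exact (Quot.sound (CovObj.VRel.mk (S := D.cover h𝒢 n) w g _)).symm

end PointSeq

/-! ### LOCAL TRANSPORT at one level, tree form -/

/-- **LOCAL TRANSPORT of fixed branches between two tree vertices over one base vertex** ([SemiAnbd]
Thm 3.7 (iii) / Comments (6)(b) at ONE level `n` of a Galois tower, for a TOPOLOGICALLY CYCLIC edge
group `Π_{e(b₀)}`): let `v_a`, `v` be vertices of `𝔾̃_n` over the base vertex `w` (over which a compatible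
point sequence `P₀` is given), let a subgroup `C` of `π₁^temp(𝒢)` fix (at level `n`) the edge of a branch
`α` at `v_a` over the base branch `b₀`, and the edges of two branches `β`, `β'` at `v` over `b₀` and over
`b₁`.  Then `C` fixes the edge of some branch `α'` at `v_a` over `b₁`.  (The element of `Gal(𝒢_{∞,n}/𝒢)`
carrying `β` to `α` normalises the image of `C`, whose conjugates inside the one finite cyclic image of
`Π_{b₀}` are determined by their order.) [cite: MochizukiSemiAnbd2006, Thm 3.7(iii) p.41] -/
theorem exists_fixed_branch_transport (D : GaloisLevelData 𝒢) (h𝒢 : 𝒢.IsCountable) (n : ℕ)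
    (C : Subgroup (D.temperedPi h𝒢)) {w : 𝒢.graph.Vertex} (P₀ : D.PointSeq h𝒢 w)
    {b₀ b₁ : 𝒢.graph.Branch} (hb₀ : 𝒢.graph.abuts b₀ = some w) (hb₁ : 𝒢.graph.abuts b₁ = some w)
    (t₀ : 𝒢.Ge (𝒢.graph.edgeOf b₀)) (hgen : (Subgroup.zpowers t₀).topologicalClosure = ⊤)
    {va v : (D.tree n).Vertex} (hva : (D.treeProj n).vertexMap va = w)
    (hv : (D.treeProj n).vertexMap v = w)
    (α β β' : (D.tree n).Branch) (hα : (D.tree n).abuts α = some va)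
    (hαb : (D.treeProj n).branchMap α = b₀) (hβ : (D.tree n).abuts β = some v)
    (hβb : (D.treeProj n).branchMap β = b₀) (hβ' : (D.tree n).abuts β' = some v)
    (hβ'b : (D.treeProj n).branchMap β' = b₁)
    (hfixα : ∀ g ∈ C, (D.treeAct h𝒢 n g).hom.edgeMap ((D.tree n).edgeOf α) = (D.tree n).edgeOf α)
    (hfixβ : ∀ g ∈ C, (D.treeAct h𝒢 n g).hom.edgeMap ((D.tree n).edgeOf β) = (D.tree n).edgeOf β)
    (hfixβ' : ∀ g ∈ C, (D.treeAct h𝒢 n g).hom.edgeMap ((D.tree n).edgeOf β') = (D.tree n).edgeOf β') :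
    ∃ α' : (D.tree n).Branch, (D.tree n).abuts α' = some va ∧ (D.treeProj n).branchMap α' = b₁ ∧
      ∀ g ∈ C, (D.treeAct h𝒢 n g).hom.edgeMap ((D.tree n).edgeOf α') = (D.tree n).edgeOf α' := by
  classical
  obtain ⟨P, hPv⟩ : ∃ P : D.PointSeq h𝒢 w, P.vertex n = v := P₀.exists_pointSeq_vertex_eq_of_treeProj n v hv
  obtain ⟨Pa, hPva⟩ : ∃ P : D.PointSeq h𝒢 w, P.vertex n = va :=
    P₀.exists_pointSeq_vertex_eq_of_treeProj n va hva
  obtain ⟨σa₀, hσa₀⟩ := P.exists_gal_fV_eq n (Pa.pt n)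
  -- generic step: a tree branch `γ` over `b` at the vertex of the orbit of `τ₀ · pt`, in cover coordinates
  have key : ∀ (b : 𝒢.graph.Branch) (hb : 𝒢.graph.abuts b = some w) (γ : (D.tree n).Branch)
      (τ₀ : D.Gal h𝒢 n),
      (D.tree n).abuts γ = some ((D.treeIso h𝒢 n).hom.vertexMap
        (Quot.mk _ ⟨w, (τ₀.hom.fV w).hom.hom (P.pt n)⟩)) →
      (D.treeProj n).branchMap γ = b →
      (∀ g ∈ C, (D.treeAct h𝒢 n g).hom.edgeMap ((D.tree n).edgeOf γ) = (D.tree n).edgeOf γ) →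
      ∃ τ : D.Gal h𝒢 n,
        (Quot.mk (D.cover h𝒢 n).VRel ⟨w, (τ.hom.fV w).hom.hom (P.pt n)⟩ : (D.cover h𝒢 n).OVertex) =
          Quot.mk (D.cover h𝒢 n).VRel ⟨w, (τ₀.hom.fV w).hom.hom (P.pt n)⟩ ∧
        (D.treeIso h𝒢 n).inv.branchMap γ = (D.cover h𝒢 n).brOf b hb ((τ.hom.fV w).hom.hom (P.pt n)) ∧
        ∀ q ∈ C.map (D.proj h𝒢 n), ∃ k ∈ 𝒢.branchSubgroup b w hb, ((D.cover h𝒢 n).SV w).obj.ρ k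
          ((q.hom.fV w).hom.hom ((τ.hom.fV w).hom.hom (P.pt n))) = (τ.hom.fV w).hom.hom (P.pt n) := by
    intro b hb γ τ₀ hγ hγb hfixγ
    set γ₀ := (D.treeIso h𝒢 n).inv.branchMap γ with hγ₀
    have hγeq : γ = (D.treeIso h𝒢 n).hom.branchMap γ₀ := (D.treeIso_hom_branchMap_inv h𝒢 n γ).symm
    have hγ₀b : γ₀.1.1 = b := by rw [← hγb, hγeq, D.treeProj_branchMap_treeIso h𝒢]
    have hγ₀a : (D.cover h𝒢 n).orbitGraph.abuts γ₀ =
        some (Quot.mk _ ⟨w, (τ₀.hom.fV w).hom.hom (P.pt n)⟩) := by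
      apply D.orbitGraph_abuts_of_tree_abuts h𝒢
      rw [← hγeq]
      exact hγ
    -- `γ₀ = brOf b y` with `y` in the orbit of `τ₀ · pt`, and `y = τ · pt`
    obtain ⟨y, hy⟩ := (D.cover h𝒢 n).exists_eq_brOf b hb γ₀ hγ₀b
    have hyorb : (Quot.mk (D.cover h𝒢 n).VRel ⟨w, y⟩ : (D.cover h𝒢 n).OVertex) =
        Quot.mk (D.cover h𝒢 n).VRel ⟨w, (τ₀.hom.fV w).hom.hom (P.pt n)⟩ := by
      have h := (D.cover h𝒢 n).abuts_brOf b hb y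
      rw [← hy, hγ₀a] at h
      exact (Option.some.inj h).symm
    obtain ⟨τ, hτ⟩ := P.exists_gal_fV_eq n y
    refine ⟨τ, ?_, ?_, ?_⟩
    · rw [hτ]; exact hyorb
    · rw [hτ]; exact hy
    · rintro _ ⟨g, hg, rfl⟩
      -- `g` fixes the branch `γ`, hence `ρ_n(g)` fixes `γ₀ = brOf b y`
      have hfixbr : (D.treeAct h𝒢 n g).hom.branchMap γ = γ :=
        SemiGraph.branchMap_eq_of_over_aut (D.treeProj n) (D.treeAct h𝒢 n g) (D.treeAct_over h𝒢 n g) γ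
          (hfixγ g hg)
      have h1 := hfixbr
      rw [D.treeAct_apply, hγeq, D.galTreeAct_branchMap_treeIso h𝒢] at h1
      have h2 := congrArg (D.treeIso h𝒢 n).inv.branchMap h1
      rw [D.treeIso_inv_branchMap_hom h𝒢, D.treeIso_inv_branchMap_hom h𝒢, hy,
        (D.cover h𝒢 n).branchMap_brOf b hb, (D.cover h𝒢 n).brOf_eq_brOf_iff b hb] at h2
      rw [hτ]
      exact h2
  have hαv : (D.tree n).abuts α = some ((D.treeIso h𝒢 n).hom.vertexMap
      (Quot.mk _ ⟨w, (σa₀.hom.fV w).hom.hom (P.pt n)⟩)) := by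
    rw [hσa₀]; rw [← hPva] at hα; exact hα
  have hβv : (D.tree n).abuts β = some ((D.treeIso h𝒢 n).hom.vertexMap
      (Quot.mk _ ⟨w, ((1 : D.Gal h𝒢 n).hom.fV w).hom.hom (P.pt n)⟩)) := by
    rw [← hPv] at hβ; exact hβ
  have hβ'v : (D.tree n).abuts β' = some ((D.treeIso h𝒢 n).hom.vertexMap
      (Quot.mk _ ⟨w, ((1 : D.Gal h𝒢 n).hom.fV w).hom.hom (P.pt n)⟩)) := by
    rw [← hPv] at hβ'; exact hβ'
  obtain ⟨σa, hσa, -, hMα⟩ := key b₀ hb₀ α σa₀ hαv hαb hfixα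
  obtain ⟨σ, hσ, -, hMβ⟩ := key b₀ hb₀ β 1 hβv hβb hfixβ
  obtain ⟨σ', hσ', -, hMβ'⟩ := key b₁ hb₁ β' 1 hβ'v hβ'b hfixβ'
  have htr := P.forall_exists_branchSubgroup_ρ_apply_eq_transport n hb₀ hb₁ t₀ hgen
    (C.map (D.proj h𝒢 n)) σa σ σ' hMα hMβ hMβ'
  set z := ((σa * σ⁻¹ * σ').hom.fV w).hom.hom (P.pt n) with hz
  refine ⟨(D.treeIso h𝒢 n).hom.branchMap ((D.cover h𝒢 n).brOf b₁ hb₁ z), ?_, ?_, ?_⟩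
  · -- abuts `v_a`: the orbit of `z` is that of `σa · pt`, i.e. of `σa₀ · pt = Pa.pt n`
    have horb : (Quot.mk (D.cover h𝒢 n).VRel ⟨w, z⟩ : (D.cover h𝒢 n).OVertex) =
        Quot.mk (D.cover h𝒢 n).VRel ⟨w, (σa₀.hom.fV w).hom.hom (P.pt n)⟩ := by
      rw [hz, P.mk_mul_inv_mul_fV_eq n σa σ σ' (hσ.trans hσ'.symm), hσa]
    have h := (D.treeIso h𝒢 n).hom.abuts_branchMap _ _ ((D.cover h𝒢 n).abuts_brOf b₁ hb₁ z)
    rw [h, horb, hσa₀, ← hPva]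
    rfl
  · rw [D.treeProj_branchMap_treeIso h𝒢]
    rfl
  · intro g hg
    have hq : D.proj h𝒢 n g ∈ C.map (D.proj h𝒢 n) := ⟨g, hg, rfl⟩
    obtain ⟨k, hk, hkz⟩ := htr _ hq
    have hbr : (CovObj.orbitGraphMap (D.proj h𝒢 n g).hom).branchMap ((D.cover h𝒢 n).brOf b₁ hb₁ z) =
        (D.cover h𝒢 n).brOf b₁ hb₁ z := by
      rw [(D.cover h𝒢 n).branchMap_brOf b₁ hb₁, (D.cover h𝒢 n).brOf_eq_brOf_iff b₁ hb₁]
      exact ⟨k, hk, hkz⟩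
    have hbr' : (D.treeAct h𝒢 n g).hom.branchMap
        ((D.treeIso h𝒢 n).hom.branchMap ((D.cover h𝒢 n).brOf b₁ hb₁ z)) =
        (D.treeIso h𝒢 n).hom.branchMap ((D.cover h𝒢 n).brOf b₁ hb₁ z) := by
      rw [D.treeAct_apply, D.galTreeAct_branchMap_treeIso h𝒢, hbr]
    rw [← (D.treeAct h𝒢 n g).hom.edgeOf_branchMap, hbr']

end GaloisLevelData

end ProfiniteSemiGraph

end Literature.AnabelianGeometry.SemiGraphs
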